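import Summits.HodgeConjecture.HodgeConjecture.Theorems.F0P3SpectralPacketXiHSigned   -- ★ (N) FILE 3r: `SpectralPacketH.IsSignedXiImageOf`, `XiHPacketsSigned`, `rhoXiS` (+ ★ 1 `LocalPacketKit.UnramLaw`, ★ 3b `UnrDefLaw`)
import Summits.HodgeConjecture.HodgeConjecture.Theorems.F0P3GlobalPacketOfAPackets    -- ★ (N) FILE 3b: (ℓ9) `UnrDefLaw`
import HarnessLib

/-!
# The SIGNED pairing of a ξ-image token is `+1` wherever that token is unramified — a kit-generic consequence of (KG1) `UnramLaw` and (PK-SHAPE-H)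

Cell `hodgecm-mathlib`, F0∕P3c line LH7 (closer stub `stub_PKtuple : PKtupleLetter`, `Cruxes/H413/Lines/F0_U3LettersRung1.lean` ED. 38 «PK-ε», row #181),
crux H413 = `stmt-HodgeConjecture-24833`; organ payer LH7-p01 (g0).  `--supports stmt-HodgeConjecture-24833 --as helper`; closes no stub.

THE MATHEMATICS (three lines).  In the (N) tuple letter the kit family `𝔩` obeys (KG1) ★ `LocalPacketKit.UnramLaw` at every finite `v`, whose last clause is print՚s
«`⟨ρ_v, π_v⁰⟩ = 1` if `π_v` is unramified» [Rogawski1990 §13.3 p. 203 l. 1–3]: `∀ ρ, ξ_H(ρ) = P → pair ρ (sph P h) = 1` for every unramified token `P`.  The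
`H`-side shape (PK-SHAPE-H) ★ `XiHPacketsSigned … ε κH` hands, for every one-dimensional automorphic `ξ`, a packet `ρ = rhoXiS ξ` with ★ `IsSignedXiImageOf`:
the pairing `pair ρ_v` is CONSTANT `= ε ξ v` on the members of `ξ_H(ρ_v)` [Prop. 13.1.4 at the tree՚s signed factor `Δ‴_v`, RULING K2: `ε ξ v = ε_v(H)`].  Since
`sph ∈ mem (ξ_H(ρ_v))` (first clause of `UnramLaw`), the two read together give: **`ε ξ v = 1` at every finite `v` where the token `ξ_H(ρ_v)` is flagged unramified** —
in particular (★ `SpectralPacketH.cofinite_unrH`) at all but finitely many `v`, and, under (KG2) ★ `UnrDefLaw`, at every `v` where SOME member of the transported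
A-packet `Π(ξ_v)` is `K_v`-spherical.  This file records these consequences of the letter՚s own conjuncts; it asserts nothing about the record.
USE (LH7 census flag F10, `F0/P3c/LH7/LH7-p01/g0/MEMO-KG1-signed-pairing.v1.md`): combined with (KT2) `CharIdentityψ` at `ρ = ξ` and the signed package `hQ`
(which force `pair = ε_v(H)` on `Π(ξ_v)` at the explicit factor `Δ‴_v = ε_v(H)·Δ_v∘ψ_v`), the letter can only hold at frames∕kits where `ε_v(H) = +1` at every
place `v` at which some `Π(ξ_v)`-token is unramified — the desk decides whether that is a misstatement of (KG1)՚s pairing clause (print՚s `⟨·,·⟩` is the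
CANONICAL pairing, the tree՚s `pair` is the `Δ‴`-signed one).

CONTENTS (namespace `…Cruxes.H413.F0P3SpectralPacket.SpectralPacketH`, dot-notation on ★ `IsSignedXiImageOf`):
* `IsSignedXiImageOf.eps_eq_one_of_unr` — (KG1) at `v` + signed image ⇒ `unr (ξ_H(ρ_v)) → ε v = 1`.
* `IsSignedXiImageOf.eps_eq_one_of_mem_isSpherical` — with (KG2): a `K_v`-spherical member of `ξ_H(ρ_v)` ⇒ `ε v = 1`.
* `IsSignedXiImageOf.eps_eq_one_of_isSpherical_πn` — the A-packet reading: `(Pk v).πn` spherical ⇒ `ε v = 1`.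
* `IsSignedXiImageOf.eventually_eps_eq_one` — `ε v = 1` for cofinitely many `v` (from `ρ.cofinite_unrH`).
* `eps_eq_one_of_xiHPacketsSigned_of_unr` — the letter-level reading at `ρ = rhoXiS h ξ`.
No instance, no notation, no named fact, no `sorry`.
HONEST LABEL: HC_CM is proved only modulo the 7 printed citations (2 remaining: hLiu418 = stmt-HodgeConjecture-24832, h413 = stmt-HodgeConjecture-24833) until rung 0 closes;
this file proves no printed statement.

References: [Rogawski1990] §13.3 p. 203 l. 1–3 (`⟨ρ_v, π_v⁰⟩ = ⟨1, π_v⟩ = 1` if `π_v` is unramified), §13.1 Thm. 13.1.1 (2) p. 198, Prop. 13.1.4 p. 199; §14.6 pp. 242–244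
(`Δ′_v = c_v Δ″_v`, `c = ∏ c_v = ±1`, «`Tr ρ_v(f′^H_v) = −c_v ⟨ρ_v, π′_v⟩ Tr π′_v(f′_v)`» — print keeps `c_v` OUTSIDE the pairing).
-/

set_option autoImplicit false
-- the mandated namespace repeats `HodgeConjecture.HodgeConjecture`, as in every `Theorems/*.lean` of this sub-problem
set_option linter.dupNamespace false

noncomputable section

open NumberField IsDedekindDomain MeasureTheory Filter
open scoped Matrix MatrixGroups

open Literature.NumberTheory Literature.NumberTheory.Automorphic Literature.NumberTheory.Automorphic.UnitaryGroup
open Literature.NumberTheory.Rogawski1990 Literature.NumberTheory.GaloisRepresentations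
open Literature.RepresentationTheory.BorelWallach2000 Literature.RepresentationTheory.KonnoKonno2007
open Summit.HodgeConjecture.HodgeConjecture.Cruxes.H413.F0P3LocalPacketKit
open Summit.HodgeConjecture.HodgeConjecture.Cruxes.H413.F0P3ArchPacketKit

namespace Summit.HodgeConjecture.HodgeConjecture.Cruxes.H413.F0P3SpectralPacket.SpectralPacketH

open Summit.HodgeConjecture.HodgeConjecture.Cruxes.H413.F0P3GlobalPacket
open Summit.HodgeConjecture.HodgeConjecture.Cruxes.H413.F0P3ArchPacketKit.ArchPacketKitH

variable {L : Type} [Field L] [NumberField L] [IsCMField L] {H' : Matrix (Fin 3) (Fin 3) L}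
  {𝔩 : ∀ v : HeightOneSpectrum (𝓞 ↥(maximalRealSubfield L)), LocalPacketKit L H' v} {𝔞 : ArchPacketKit} {𝔞H : ArchPacketKitH 𝔞}
  {DiscH : GlobalPacketH 𝔩 → 𝔞H.PktInfH → Prop}
  {ρ : SpectralPacketH 𝔩 𝔞 𝔞H DiscH} {Pk : ∀ v : HeightOneSpectrum (𝓞 ↥(maximalRealSubfield L)), CMLocalAPacket L H' v}
  {PkInf : LocalAPacket (GKIrrClass (uFormGroup (Fin 2) (Fin 1)))} {ε : HeightOneSpectrum (𝓞 ↥(maximalRealSubfield L)) → ℤ} {κH : ℤ}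

/-! ## §1 At one place: (KG1) + the signed image -/

/-- **THE SIGNED PAIRING IS `+1` AT AN UNRAMIFIED IMAGE TOKEN**: if `ρ_v`՚s endoscopic image `ξ_H(ρ_v)` carries the constant pairing `ε v` (★ `IsSignedXiImageOf`) and the kit
obeys (KG1) ★ `UnramLaw` at `v`, then `unr (ξ_H(ρ_v)) → ε v = 1`: the spherical member `sph` lies in `ξ_H(ρ_v)`, print՚s clause gives `pair ρ_v sph = 1`, the shape gives
`pair ρ_v sph = ε v`. [cite: Rogawski1990, §13.3 p. 203 l. 1–3; §13.1 Prop. 13.1.4 p. 199] -/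
theorem IsSignedXiImageOf.eps_eq_one_of_unr (h : ρ.IsSignedXiImageOf Pk PkInf ε κH) {v : HeightOneSpectrum (𝓞 ↥(maximalRealSubfield L))}
    (h4 : (𝔩 v).UnramLaw) (hunr : (𝔩 v).unr ((𝔩 v).xiH (ρ.fin.loc v))) : ε v = 1 := by
  obtain ⟨hmem, -, -, -, hpair⟩ := h4 ((𝔩 v).xiH (ρ.fin.loc v)) hunr
  rw [← h.pair_eq v hmem]
  exact hpair (ρ.fin.loc v) rfl

/-- **WITH (KG2)**: a `K_v`-SPHERICAL MEMBER of `ξ_H(ρ_v)` (`K_v = cmLocalIntegralLevel`) flags the token unramified (★ `UnrDefLaw`), hence `ε v = 1`.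
[cite: Rogawski1990, §13.3 p. 201 ¶2, p. 203 l. 1–3] -/
theorem IsSignedXiImageOf.eps_eq_one_of_mem_isSpherical (h : ρ.IsSignedXiImageOf Pk PkInf ε κH) {v : HeightOneSpectrum (𝓞 ↥(maximalRealSubfield L))}
    (h4 : (𝔩 v).UnramLaw) (h9 : UnrDefLaw (𝔩 v)) {c : IrrClass ((UnitaryGroup.cmDatum L 3 H').Local v)}
    (hc : c ∈ (𝔩 v).mem ((𝔩 v).xiH (ρ.fin.loc v))) (hsph : c.IsSpherical (cmLocalIntegralLevel L 3 H' v)) : ε v = 1 :=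
  h.eps_eq_one_of_unr h4 ((h9 _).2 ⟨c, hc, hsph⟩)

/-- **THE A-PACKET READING**: if the non-tempered member `(Pk v).πn` of the A-packet datum carried by `ξ_H(ρ_v)` is `K_v`-spherical, then `ε v = 1` ((KG1) + (KG2)).
For the (N) tuple (`Pk := transportAPackets 𝔨.ψ Pk′ ξ`): wherever the transported `πⁿ(ξ_v)` is `K_v`-spherical, the letter՚s sign `ε ξ v` is `+1`.
[cite: Rogawski1990, §13.3 p. 203 l. 1–3; §13.1 Prop. 13.1.3 (d), Prop. 13.1.4 p. 199] -/
theorem IsSignedXiImageOf.eps_eq_one_of_isSpherical_πn (h : ρ.IsSignedXiImageOf Pk PkInf ε κH) {v : HeightOneSpectrum (𝓞 ↥(maximalRealSubfield L))}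
    (h4 : (𝔩 v).UnramLaw) (h9 : UnrDefLaw (𝔩 v)) (hsph : (Pk v).πn.IsSpherical (cmLocalIntegralLevel L 3 H' v)) : ε v = 1 :=
  h.eps_eq_one_of_mem_isSpherical h4 h9 ((h.mem_xiH_iff v (Pk v).πn).2 (Or.inl rfl)) hsph

/-- **COFINITELY**: every spectral `H`-packet has `ξ_H(ρ_v)` unramified for almost all `v` (★ `SpectralPacketH.cofinite_unrH`), so under (KG1) the signed pairing of a
ξ-image is `+1` at all but finitely many places. [cite: Rogawski1990, §13.3 p. 201 ¶2, p. 203 l. 1–3] -/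
theorem IsSignedXiImageOf.eventually_eps_eq_one (h : ρ.IsSignedXiImageOf Pk PkInf ε κH)
    (h4 : ∀ v : HeightOneSpectrum (𝓞 ↥(maximalRealSubfield L)), (𝔩 v).UnramLaw) : ∀ᶠ v in cofinite, ε v = 1 :=
  ρ.cofinite_unrH.mono fun _ hv => h.eps_eq_one_of_unr (h4 _) hv

/-! ## §2 The letter-level reading at `ρ = rhoXiS h ξ` -/

variable {PkX : OneDimAutRepH L → ∀ v : HeightOneSpectrum (𝓞 ↥(maximalRealSubfield L)), CMLocalAPacket L H' v}
  {PkInfX : OneDimAutRepH L → LocalAPacket (GKIrrClass (uFormGroup (Fin 2) (Fin 1)))}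
  {χ : OneDimAutRepH L → ∀ v : HeightOneSpectrum (𝓞 ↥(maximalRealSubfield L)),
    (UnitaryGroup.cmDatum L 2 (Matrix.of fun i j : Fin 2 => if i.val + j.val + 1 = 2 then (1 : L) else 0)).Local v ×
      (UnitaryGroup.cmDatum L 1 (Matrix.of fun i j : Fin 1 => if i.val + j.val + 1 = 1 then (1 : L) else 0)).Local v →* ℂˣ}
  {hχ : ∀ (ξ : OneDimAutRepH L) (v : HeightOneSpectrum (𝓞 ↥(maximalRealSubfield L))),
    IsOpen (((χ ξ v).ker : Subgroup ((UnitaryGroup.cmDatum L 2 (Matrix.of fun i j : Fin 2 => if i.val + j.val + 1 = 2 then (1 : L) else 0)).Local v ×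
      (UnitaryGroup.cmDatum L 1 (Matrix.of fun i j : Fin 1 => if i.val + j.val + 1 = 1 then (1 : L) else 0)).Local v)) :
      Set ((UnitaryGroup.cmDatum L 2 (Matrix.of fun i j : Fin 2 => if i.val + j.val + 1 = 2 then (1 : L) else 0)).Local v ×
        (UnitaryGroup.cmDatum L 1 (Matrix.of fun i j : Fin 1 => if i.val + j.val + 1 = 1 then (1 : L) else 0)).Local v))}
  {εX : OneDimAutRepH L → HeightOneSpectrum (𝓞 ↥(maximalRealSubfield L)) → ℤ} {κHX : OneDimAutRepH L → ℤ}

/-- **(PK-SHAPE-H) + (KG1) ⇒ `ε ξ v = 1` WHEREVER `ξ_H((rhoXiS ξ)_v)` IS UNRAMIFIED** — the letter-level form: for the tuple՚s `ρXi ξ := rhoXiS h ξ`, the sign `ε ξ v` that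
(PK-SHAPE-H) writes into the kit՚s pairing equals `+1` at every place where that token is flagged unramified. [cite: Rogawski1990, §13.3 p. 203 l. 1–3] -/
theorem eps_eq_one_of_xiHPacketsSigned_of_unr (h : XiHPacketsSigned 𝔩 𝔞 𝔞H DiscH PkX PkInfX χ hχ εX κHX)
    (h4 : ∀ v : HeightOneSpectrum (𝓞 ↥(maximalRealSubfield L)), (𝔩 v).UnramLaw) (ξ : OneDimAutRepH L)
    {v : HeightOneSpectrum (𝓞 ↥(maximalRealSubfield L))} (hunr : (𝔩 v).unr ((𝔩 v).xiH ((rhoXiS h ξ).fin.loc v))) : εX ξ v = 1 :=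
  (rhoXiS_isSignedXiImageOf h ξ).eps_eq_one_of_unr (h4 v) hunr

/-- The same with (KG2): a `K_v`-spherical transported `πⁿ(ξ_v)` (`(PkX ξ v).πn`) forces `ε ξ v = 1`. [cite: Rogawski1990, §13.3 p. 201 ¶2, p. 203 l. 1–3] -/
theorem eps_eq_one_of_xiHPacketsSigned_of_isSpherical_πn (h : XiHPacketsSigned 𝔩 𝔞 𝔞H DiscH PkX PkInfX χ hχ εX κHX)
    (h4 : ∀ v : HeightOneSpectrum (𝓞 ↥(maximalRealSubfield L)), (𝔩 v).UnramLaw)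
    (h9 : ∀ v : HeightOneSpectrum (𝓞 ↥(maximalRealSubfield L)), UnrDefLaw (𝔩 v)) (ξ : OneDimAutRepH L)
    {v : HeightOneSpectrum (𝓞 ↥(maximalRealSubfield L))} (hsph : (PkX ξ v).πn.IsSpherical (cmLocalIntegralLevel L 3 H' v)) : εX ξ v = 1 :=
  (rhoXiS_isSignedXiImageOf h ξ).eps_eq_one_of_isSpherical_πn (h4 v) (h9 v) hsph

/-- Cofinitely in `v`, for every `ξ`. [cite: Rogawski1990, §13.3 p. 201 ¶2, p. 203 l. 1–3] -/
theorem eventually_eps_eq_one_of_xiHPacketsSigned (h : XiHPacketsSigned 𝔩 𝔞 𝔞H DiscH PkX PkInfX χ hχ εX κHX)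
    (h4 : ∀ v : HeightOneSpectrum (𝓞 ↥(maximalRealSubfield L)), (𝔩 v).UnramLaw) (ξ : OneDimAutRepH L) : ∀ᶠ v in cofinite, εX ξ v = 1 :=
  (rhoXiS_isSignedXiImageOf h ξ).eventually_eps_eq_one h4

end Summit.HodgeConjecture.HodgeConjecture.Cruxes.H413.F0P3SpectralPacket.SpectralPacketH

end
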